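import Literature.Probability.RandomPlanarGeometry.HexSAWSurfaceWallRenewalBlocksEightA
import Literature.Probability.RandomPlanarGeometry.HexSAWSurfaceWallRenewalBlocksEightB
import HarnessLib

/-!
# The order-EIGHT diagonal census, part A (kernel-verified pruned search): `N₉,₁ = 98`, `N₁₀,₂ = 99` exactly;
# `#(ipwb 18) = 133`, `Λ₁₈(y) = 98y + 34y² + y³`, `f₉(y) = (98y + 34y² + y³)/β(y)¹⁸`, `Λ₂₀(y) = N₁₀,₁·y + 99y² + 7y³`

Topic `Literature/Probability/RandomPlanarGeometry` (lane «pcv-sawmu», a-p6 g20, car «CENSUS-EIGHT-A»; parents: this seat's «BLOCKS-EIGHT-A/B»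
`HexSAWSurfaceWallRenewalBlocksEightA/B` (the exhibited tables `EighteenOne.W : Fin 98 → _`, `TwentyTwo.W : Fin 99 → _`, `TwentyTwoThree.W : Fin 33 → _`,
`TwentyFourFour.W : Fin 1 → _` with `W_mem_ipwb`, `visits_W`, `W_injective` — the LOWER halves `N₉,₁ ≥ 98`, `N₁₀,₂ ≥ 99`), and a-idea-1 g34's «SEVEN-CENSUS»
`HexSAWSurfaceWallRenewalCensusSeven` (the SYMBOLIC search `WCensus.censusW N V` with its completeness theorem `WCensus.revList_mem_censusW`, stated for every
`N`, `V`; `IPWB_eighteen_eq : Λ₁₈ = N₉,₁·y + 34y² + y³`, `IPWB_twenty_eq : Λ₂₀ = N₁₀,₁·y + N₁₀,₂·y² + 7y³`, `card_ipwb_eighteen_eq : #(ipwb 18) = N₉,₁ + 35`)).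

## The method
Exactly car 72's: the UPPER halves are obtained COMBINATORIALLY by the pruned depth-first enumeration `WCensus.grow` of reversed site lists with the
completeness theorem `WCensus.revList_mem_censusW` (symbolic `N`, `V`), and two KERNEL CERTIFICATES (`decide +kernel`) that every enumerated list of the
`(18, 1)` / `(20, 2)` census is the site list of one of the 98 / 99 exhibited tables (`2151` / `12242` search nodes by this seat's count; measured on the farm
before filing: ≈ `20 s` / ≈ `110 s`; budget lines `4000000`).  The classes `(22, 3)` and `(24, 4)` of the same diagonal are NOT certified here: a single-shot
kernel evaluation of the `(22, 3)` census (`46866` nodes) exhausts the kernel's memory («(kernel) excessive memory consumption detected» after 20 min on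
the farm) and must be split over prefixes with `WCensus.forall_mem_grow_succ` (part B); `(24, 4)` (`155513` nodes) is the `k = 4` instance of the equality
case of the six-step law (a-idea-1 g35's «SIX-STEP-RIGIDITY» programme).

Sources (primary; identifiers verbatim).  N. Madras, G. Slade, The Self-Avoiding Walk (1993): Section 1.2, Definition 1.2.4 (bridges); Section 4.2,
Definition 4.2.1 (renewal times, irreducible bridges), (4.2.2) (`λ_n`, `Λ`), (4.2.4) and Theorem 4.2.2 (pp. 91–92).  H. Kesten, J. Math. Phys. 4 (1963),
Section 4.  N. R. Beaton et al., CMP 326 (2014), Section 3.1 (arXiv v5 p. 8: surface contacts, fugacity `y`).  I. G. Enting, I. Jensen (2009), Section 7.4.2,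
Fig. 7.10 (brick-wall form of the honeycomb lattice).

## What is proved (namespace `…SAW.HexBW.Wall`; walk lengths symbolic in every statement about `ipwb`)
* §1 KERNEL CERTIFICATES `EighteenOne.censusW_subset`, `TwentyTwo.censusW_subset`.
* §2 ★★★ THE CENSUS: `exists_eq_eighteenOne_W_of_mem_ipwb_eighteen_of_visits_eq_one`, `oneVisit_ipwb_eighteen_eq_image`,
  ★★★ `card_oneVisit_ipwb_eighteen_eq_ninetyEight` (**`N₉,₁ = 98`**), ★★ `card_ipwb_eighteen_eq_oneThirtyThree` (**`N₉ = 133`**);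
  `exists_eq_twentyTwo_W_of_mem_ipwb_twenty_of_visits_eq_two`, `twoVisit_ipwb_twenty_eq_image`, ★★★ `card_twoVisit_ipwb_twenty_eq_ninetyNine` (**`N₁₀,₂ = 99`**).
* §3 LAWS: ★★★ `IPWB_eighteen_eq_ninetyEight : Λ₁₈(y) = 98y + 34y² + y³`, ★★ `pwbLaw_nine_eq_exact : f₉ = (98y + 34y² + y³)/β¹⁸` (the renewal law is explicit
  through half-length NINE), ★ `IPWB_twenty_eq_ninetyNine : Λ₂₀ = N₁₀,₁·y + 99y² + 7y³` (`N₁₀,₁` symbolic: diagonal `9`).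

NOT claimed: `N₁₁,₃`, `N₁₂,₄` (data `33`, `1`; the sibling tables exhibit `≥`), `N₁₀,₁`, `N₁₁,₁`, `N₁₁,₂`, … (diagonals `≥ 9`); the eighth β²-coefficient `a₇ = 18`
(the floor `≥ 18` is «EIGHTH-FLOOR»; the ceiling needs `(22,3)` and `(24,4)`); anything asymptotic.  NEW IN WRITING (modest): two diagonal-eight class numbers of
the positive wall-bridge renewal structure of the adsorbing honeycomb walk, kernel-certified, and the exact ninth block law.  Label (lane): DATA-LEMMA / kernel
census + completeness theorem; budget lines: 2 (`set_option maxHeartbeats 4000000 in` before each certificate).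
-/

namespace Literature.Probability.RandomPlanarGeometry.SAW.HexBW.Wall

open Finset Function Census
open Literature.Probability.LatticeModels

/-! ### §1  The kernel certificates -/

namespace EighteenOne

/-- The 98 tables as reversed site lists. [cite: EntingJensen2009, Section 7.4.2, Fig. 7.10] -/
def revLists : List (List (ℤ × ℤ)) := (List.finRange 98).map fun i => revList (W i) 18

set_option maxHeartbeats 4000000 in
/-- **Kernel certificate** (`2151` search nodes): every list of the `(18, 1)` census is one of the 98 tables. [cite: MadrasSlade1993, Section 4.2, Definition 4.2.1, (4.2.2)] -/
theorem censusW_subset : ∀ l ∈ WCensus.censusW 18 1, l ∈ revLists := by decide +kernel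

end EighteenOne

namespace TwentyTwo

/-- The 99 tables as reversed site lists. [cite: EntingJensen2009, Section 7.4.2, Fig. 7.10] -/
def revLists : List (List (ℤ × ℤ)) := (List.finRange 99).map fun i => revList (W i) 20

set_option maxHeartbeats 4000000 in
/-- **Kernel certificate** (`12242` search nodes): every list of the `(20, 2)` census is one of the 99 tables. [cite: MadrasSlade1993, Section 4.2, Definition 4.2.1, (4.2.2)] -/
theorem censusW_subset : ∀ l ∈ WCensus.censusW 20 2, l ∈ revLists := by decide +kernel

end TwentyTwo

/-! ### §2  Exhaustion and the two class numbers -/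

variable {y : ℝ}

/-- ★★ **A one-visit irreducible positive wall bridge of length eighteen is one of the 98 exhibited blocks** (symbolic length).
[cite: MadrasSlade1993, Section 4.2, Definition 4.2.1, (4.2.2)] [cite: Kesten1963SAW, Section 4] [cite: EntingJensen2009, Section 7.4.2, Fig. 7.10] -/
theorem exists_eq_eighteenOne_W_of_mem_ipwb_eighteen_of_visits_eq_one {m : ℕ} {ω : ℕ → Site 2} (hm : m = 18) (hω : ω ∈ ipwb m)
    (hv : visits m ω = 1) : ∃ i : Fin 98, ω = EighteenOne.W i := by
  have h1 := WCensus.revList_mem_censusW hω hv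
  rw [hm] at h1
  obtain ⟨i, -, hi⟩ := List.mem_map.1 (EighteenOne.censusW_subset _ h1)
  refine ⟨i, ?_⟩
  have hfr := WCensus.frozen_of_mem_ipwb hω
  have hfr' := WCensus.frozen_of_mem_ipwb (EighteenOne.W_mem_ipwb hm i)
  rw [hm] at hfr hfr'
  exact WCensus.eq_of_revList_eq hfr hfr' hi.symm

open Classical in
/-- ★★ The one-visit class of `ipwb 18` is the image of the 98 tables (symbolic length). [cite: MadrasSlade1993, Section 4.2, Definition 4.2.1, (4.2.2)] [cite: EntingJensen2009, Section 7.4.2, Fig. 7.10] -/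
theorem oneVisit_ipwb_eighteen_eq_image {m : ℕ} (hm : m = 18) :
    ((ipwb m).filter fun ω => visits m ω = 1) = Finset.univ.image EighteenOne.W := by
  ext ω
  rw [Finset.mem_filter]
  constructor
  · rintro ⟨hω, hv⟩
    obtain ⟨i, rfl⟩ := exists_eq_eighteenOne_W_of_mem_ipwb_eighteen_of_visits_eq_one hm hω hv
    exact Finset.mem_image_of_mem _ (Finset.mem_univ i)
  · intro h
    obtain ⟨i, -, rfl⟩ := Finset.mem_image.1 h
    exact ⟨EighteenOne.W_mem_ipwb hm i, by rw [hm]; exact EighteenOne.visits_W i⟩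

open Classical in
/-- ★★★ **`N₉,₁ = 98`**: there are exactly ninety-eight one-visit irreducible positive wall bridges of length eighteen (symbolic length).
[cite: MadrasSlade1993, Section 4.2, Definition 4.2.1, (4.2.2) and Theorem 4.2.2 (pp. 91–92)] [cite: Kesten1963SAW, Section 4] -/
theorem card_oneVisit_ipwb_eighteen_eq_ninetyEight {m : ℕ} (hm : m = 18) : #((ipwb m).filter fun ω => visits m ω = 1) = 98 := by
  rw [oneVisit_ipwb_eighteen_eq_image hm, Finset.card_image_of_injective _ EighteenOne.W_injective]
  simp

open Classical in
/-- ★★ **`N₉ = #(ipwb 18) = 133`** (`98 + 34 + 1`; symbolic length). [cite: MadrasSlade1993, Section 4.2, Definition 4.2.1, (4.2.2)] [cite: Kesten1963SAW, Section 4] -/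
theorem card_ipwb_eighteen_eq_oneThirtyThree {m : ℕ} (hm : m = 18) : #(ipwb m) = 133 := by
  rw [card_ipwb_eighteen_eq hm, card_oneVisit_ipwb_eighteen_eq_ninetyEight hm]

/-- ★★ **A two-visit irreducible positive wall bridge of length twenty is one of the 99 exhibited blocks** (symbolic length).
[cite: MadrasSlade1993, Section 4.2, Definition 4.2.1, (4.2.2)] [cite: Kesten1963SAW, Section 4] [cite: EntingJensen2009, Section 7.4.2, Fig. 7.10] -/
theorem exists_eq_twentyTwo_W_of_mem_ipwb_twenty_of_visits_eq_two {m : ℕ} {ω : ℕ → Site 2} (hm : m = 20) (hω : ω ∈ ipwb m)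
    (hv : visits m ω = 2) : ∃ i : Fin 99, ω = TwentyTwo.W i := by
  have h1 := WCensus.revList_mem_censusW hω hv
  rw [hm] at h1
  obtain ⟨i, -, hi⟩ := List.mem_map.1 (TwentyTwo.censusW_subset _ h1)
  refine ⟨i, ?_⟩
  have hfr := WCensus.frozen_of_mem_ipwb hω
  have hfr' := WCensus.frozen_of_mem_ipwb (TwentyTwo.W_mem_ipwb hm i)
  rw [hm] at hfr hfr'
  exact WCensus.eq_of_revList_eq hfr hfr' hi.symm

open Classical in
/-- ★★ The two-visit class of `ipwb 20` is the image of the 99 tables (symbolic length). [cite: MadrasSlade1993, Section 4.2, Definition 4.2.1, (4.2.2)] [cite: EntingJensen2009, Section 7.4.2, Fig. 7.10] -/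
theorem twoVisit_ipwb_twenty_eq_image {m : ℕ} (hm : m = 20) :
    ((ipwb m).filter fun ω => visits m ω = 2) = Finset.univ.image TwentyTwo.W := by
  ext ω
  rw [Finset.mem_filter]
  constructor
  · rintro ⟨hω, hv⟩
    obtain ⟨i, rfl⟩ := exists_eq_twentyTwo_W_of_mem_ipwb_twenty_of_visits_eq_two hm hω hv
    exact Finset.mem_image_of_mem _ (Finset.mem_univ i)
  · intro h
    obtain ⟨i, -, rfl⟩ := Finset.mem_image.1 h
    exact ⟨TwentyTwo.W_mem_ipwb hm i, by rw [hm]; exact TwentyTwo.visits_W i⟩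

open Classical in
/-- ★★★ **`N₁₀,₂ = 99`**: there are exactly ninety-nine two-visit irreducible positive wall bridges of length twenty (symbolic length).
[cite: MadrasSlade1993, Section 4.2, Definition 4.2.1, (4.2.2) and Theorem 4.2.2 (pp. 91–92)] [cite: Kesten1963SAW, Section 4] -/
theorem card_twoVisit_ipwb_twenty_eq_ninetyNine {m : ℕ} (hm : m = 20) : #((ipwb m).filter fun ω => visits m ω = 2) = 99 := by
  rw [twoVisit_ipwb_twenty_eq_image hm, Finset.card_image_of_injective _ TwentyTwo.W_injective]
  simp

/-! ### §3  Laws: `Λ₁₈ = 98y + 34y² + y³`, `f₉` exact, `Λ₂₀ = N₁₀,₁ y + 99y² + 7y³` -/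

/-- ★★★ **`Λ₁₈(y) = 98y + 34y² + y³`** (symbolic length). [cite: MadrasSlade1993, Section 4.2, (4.2.2) (p. 91)] [cite: Kesten1963SAW, Section 4] -/
theorem IPWB_eighteen_eq_ninetyEight {m : ℕ} (hm : m = 18) (y : ℝ) : IPWB m y = 98 * y + 34 * y ^ 2 + y ^ 3 := by
  classical
  rw [IPWB_eighteen_eq hm, card_oneVisit_ipwb_eighteen_eq_ninetyEight hm]
  norm_num

/-- ★★ **`f₉(y) = (98y + 34y² + y³)/β(y)¹⁸`** — the renewal law is explicit through half-length nine. [cite: MadrasSlade1993, Section 4.2, (4.2.2), (4.2.4) (p. 91)] -/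
theorem pwbLaw_nine_eq_exact (y : ℝ) : pwbLaw y 9 = (98 * y + 34 * y ^ 2 + y ^ 3) / wallRate y ^ 18 := by
  obtain ⟨m, hm⟩ : ∃ m : ℕ, m = 18 := ⟨_, rfl⟩
  have e : pwbLaw y 9 = IPWB m y / wallRate y ^ m := by rw [pwbLaw, hm]
  rw [e, IPWB_eighteen_eq_ninetyEight hm, hm]

open Classical in
/-- ★ **`Λ₂₀(y) = N₁₀,₁·y + 99y² + 7y³`** with `N₁₀,₁` the number of one-visit irreducible blocks of length twenty (symbolic; data `267`, diagonal nine).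
[cite: MadrasSlade1993, Section 4.2, (4.2.2) (p. 91)] [cite: Kesten1963SAW, Section 4] -/
theorem IPWB_twenty_eq_ninetyNine {m : ℕ} (hm : m = 20) (y : ℝ) :
    IPWB m y = #((ipwb m).filter fun ω => visits m ω = 1) * y + 99 * y ^ 2 + 7 * y ^ 3 := by
  rw [IPWB_twenty_eq hm, card_twoVisit_ipwb_twenty_eq_ninetyNine hm]
  norm_num

end Literature.Probability.RandomPlanarGeometry.SAW.HexBW.Wall
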